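import Literature.Geometry.Riemannian.SurgicalRicciFlowComponent
import Literature.Geometry.Riemannian.HamiltonSurgeryProgrammeProofs
import HarnessLib

/-!
# Chen–Zhu's Theorem 1.1 and Cerf's `Γ₄ = 0` imply Hamilton's Cor. 1.2(a)

This file closes the topological gap between the analytic top of the decomposition of
`Literature.Geometry.Riemannian.hamilton_chen_tang_zhu` — Chen–Zhu's structure theorem for the
Ricci flow with surgery on a compact simply connected 4-manifold of positive isotropic curvature,
the statement `∀ M g₀, … → ∃ m, ChenZhuResolvableIn m M g₀` (J. Differential Geom. 74 (2006),
Thm. 1.1, rendered in `SurgicalRicciFlow.lean`) — and Hamilton's Cor. 1.2(a) (Comm. Anal.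
Geom. 5 (1997): a compact simply connected PIC 4-manifold is diffeomorphic to `S⁴`), through
neck-surgery resolvability (`Literature.Geometry.Riemannian.IsNeckSurgeryResolvable`,
`HamiltonSurgeryProgramme.lean`, all of whose consequences are proved there). As explained in
`SurgicalRicciFlowTopology.lean`, Thm. 1.1 (ii)–(iii) as vended matches the collars of the
surgery caps of `M_{k+1}` with the necks of `M_k` only up to a diffeomorphism of `S³`, so the
reconstruction of `M_k` from `M_{k+1}` needs **Cerf's theorem** `π₀ Diff(S³) = 0`
(`Literature.Topology.FourManifolds.cerf_pi0Diff_sphere_three`, Cerf 1968, Théorème 1), which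
enters through `ShellCapExtension.lean` and `SurgicalRicciFlowBallAbsorption.lean`.

## Main results (all proved; hypotheses: the structure statement of Thm. 1.1 and Cerf's theorem)

**Status of Chen–Zhu's Thm. 1.1 in the tree (review of the decomposition, 2026-08-15,
D-0026/D-0027).** The structure statement `∀ M g₀, … → ∃ m, ChenZhuResolvableIn m M g₀`
(Chen–Zhu 2006, Thm. 1.1 as rendered in `SurgicalRicciFlow.lean`) is no longer a named fact
(`chenZhu_ricciFlowWithSurgery` was merged back into its parent `hamilton_chen_tang_zhu`): it is
equivalent to Hamilton's Cor. 1.2(a) modulo short-time existence of the Ricci flow and Cerf's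
theorem (`chenZhuResolvable_iff_hamilton_chen_tang_zhu`, `ChenZhuStructureFromClassification.lean`),
so it carried no proof burden of its own; it appears below verbatim as an explicit hypothesis.

* `isNeckSurgeryResolvable_of_remainder`: inner induction on the number of non-ball pieces —
  a simply connected closed `X` carrying surgery data relative to `(M', N')` whose pieces are
  necks and balls is neck-surgery resolvable, provided the simply connected components of `M'`
  are: cut a neck (`exists_transport_neckCapData`, `SurgicalRicciFlowNeckStep.lean`; sides by
  `exists_neckCapData_of_simplyConnected`, `NeckCapping.lean`) and use the `surgery`
  constructor, or, when only balls remain, identify `X` with a component of `M'`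
  (`exists_diffeomorph_component_of_ballPieces`, Cerf).
* `forall_component_isNeckSurgeryResolvable_of_chenZhuResolvableIn`: induction on the number
  `m` of surgeries in `ChenZhuResolvableIn m M g₀` — every simply connected component of `M`
  is neck-surgery resolvable (`m = 0`: `IsUnionOfPieces`, `HamiltonSurgeryProgrammeProofs.lean`;
  step: `exists_restrict_component`, projective caps excluded by
  `ProjectiveCapObstruction.lean`, discarded components are iterated connected sums of pieces).
* `isNeckSurgeryResolvable_of_chenZhu_of_cerf`: under the structure statement of Thm. 1.1 and
  `cerf_pi0Diff_sphere_three`, every closed simply connected PIC 4-manifold is neck-surgery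
  resolvable — Hamilton's surgery programme (1997, §1.1 pp. 3–4) in the simply connected case.
  (This statement is not a named fact of its own: equivalent manifold by manifold to
  Cor. 1.2(a) and reduced to the same two leaves, it would carry no proof burden, D-0026.)
* `hamilton_pic_connectedSum_spheres_four_of_chenZhu_of_cerf`,
  `hamilton_pic_sphere_four_of_chenZhu_of_cerf`, `hamilton_chen_tang_zhu_of_chenZhu_of_cerf`,
  `hamilton_pic_classification_four_of_chenZhu_of_cerf`: Hamilton's Thm. 1.1 (both vended forms)
  and Cor. 1.2(a) from the two hypotheses, via `IsNeckSurgeryResolvable.isConnectedSumOfSpheres`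
  and `S⁴ # S⁴ ≅ S⁴` (`PICSphereFactsProofs.lean`).

So the trust base of `hamilton_chen_tang_zhu` is reduced to Chen–Zhu 2006, Thm. 1.1 (whose
proof is the Ricci flow with surgery, §§2–5, on Hamilton 1997 §§2–5 and Perelman's
techniques) and Cerf 1968, Théorème 1.

## References

* R. S. Hamilton, *Four-manifolds with positive isotropic curvature*, Comm. Anal. Geom. 5 (1997)
  1–92: Thm. 1.1 (p. 2), Cor. 1.2 (p. 3), §1.1 pp. 3–4. [Hamilton1997]
* B.-L. Chen, X.-P. Zhu, *Ricci flow with surgery on four-manifolds with positive isotropic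
  curvature*, J. Differential Geom. 74 (2006) 177–264: Thm. 1.1, Cor. 1.2 (p. 3), §5 p. 25.
  [ChenZhu2006]
* J. Cerf, *Sur les difféomorphismes de la sphère de dimension trois (Γ₄ = 0)*, LNM 53 (1968),
  Ch. I §1, Théorème 1. [CerfDiffeoSphere1968]
* A. Kosinski, *Differential Manifolds* (1993), Ch. VI §§1–2. [Kosinski1993]
-/

noncomputable section

open Set Function Metric TopologicalSpace Filter
open scoped Manifold ContDiff Topology

namespace Literature.Geometry.Riemannian

open Literature.Topology.FourManifolds Lorentzian

/-! ### The translated neck of a neck piece -/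

section Neck

/-- The translated neck `ψ (θ, s) = ι (θ, s + c)` of a smooth embedding `ι : S³ × ℝ ↪ X` is a
smooth embedding with the same range. [folklore] -/
theorem isSmoothEmbedding_translate {X : Type} [TopologicalSpace X]
    [ChartedSpace (EuclideanSpace ℝ (Fin 4)) X]
    {ι : Metric.sphere (0 : EuclideanSpace ℝ (Fin 4)) 1 × ℝ → X}
    (hι : Manifold.IsSmoothEmbedding ((𝓡 3).prod 𝓘(ℝ, ℝ)) (𝓡 4) ∞ ι) (c : ℝ) :
    Manifold.IsSmoothEmbedding ((𝓡 3).prod 𝓘(ℝ, ℝ)) (𝓡 4) ∞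
        (fun q : Metric.sphere (0 : EuclideanSpace ℝ (Fin 4)) 1 × ℝ => ι (q.1, q.2 + c)) ∧
      range (fun q : Metric.sphere (0 : EuclideanSpace ℝ (Fin 4)) 1 × ℝ => ι (q.1, q.2 + c)) =
        range ι := by
  let τ : ℝ ≃ₘ⟮𝓘(ℝ, ℝ), 𝓘(ℝ, ℝ)⟯ ℝ :=
    { toFun := fun x => x + c
      invFun := fun x => x - c
      left_inv := fun x => by simp
      right_inv := fun x => by simp
      contMDiff_toFun := (contDiff_id.add contDiff_const).contMDiff
      contMDiff_invFun := (contDiff_id.sub contDiff_const).contMDiff }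
  let T := (Diffeomorph.refl (𝓡 3) (Metric.sphere (0 : EuclideanSpace ℝ (Fin 4)) 1) ∞).prodCongr τ
  have hT' : (fun q : Metric.sphere (0 : EuclideanSpace ℝ (Fin 4)) 1 × ℝ => ι (q.1, q.2 + c)) =
      ι ∘ T := by
    funext q; rfl
  refine ⟨by rw [hT']; exact hι.comp_diffeomorph T, ?_⟩
  have hTr : range (fun q => T q) = univ := Set.eq_univ_of_forall fun q => ⟨T.symm q, T.apply_symm_apply q⟩
  rw [hT', range_comp]
  change ι '' range (fun q => T q) = range ι
  rw [hTr, image_univ]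

end Neck

/-! ### The inner induction: cutting the necks of a simply connected component -/

section Inner

variable {M' : Type} [TopologicalSpace M'] [T2Space M'] [ChartedSpace (EuclideanSpace ℝ (Fin 4)) M']

/-- **All pieces balls ⇒ resolvable** (base of the inner induction): a simply connected closed
`X` whose pieces are all balls is diffeomorphic to a component `Y` of `M'`
(`exists_diffeomorph_component_of_ballPieces`, Cerf), which is simply connected with `X` and
hence resolvable by hypothesis. [cite: Hamilton1997, §1.1 pp. 3–4] -/
theorem isNeckSurgeryResolvable_of_ballPieces (hcerf : cerf_pi0Diff_sphere_three)
    {N' : Set M'} (hN' : IsClosed N') (hfin' : (componentsOf N'ᶜ).Finite)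
    (hM : ∀ C' ∈ componentsOf N'ᶜ, IsBallPiece N' C')
    (IH : ∀ Y : Opens M', (∃ y, (Y : Set M') = connectedComponent y) →
      SimplyConnectedSpace Y → IsNeckSurgeryResolvable Y)
    {X : Type} [TopologicalSpace X] [T2Space X] [CompactSpace X]
    [ChartedSpace (EuclideanSpace ℝ (Fin 4)) X] [IsManifold (𝓡 4) ∞ X] [SimplyConnectedSpace X]
    {N U : Set X} {U' : Set M'} {Φ : X → M'} {Ψ : M' → X}
    (hN : IsClosed N) (hU : IsOpen U) (hNU : N ⊆ U) (hU' : IsOpen U')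
    (hΦc : ContMDiffOn (𝓡 4) (𝓡 4) ∞ Φ U) (hΨc : ContMDiffOn (𝓡 4) (𝓡 4) ∞ Ψ U')
    (hΦ : MapsTo Φ U U') (hΨ : MapsTo Ψ U' U)
    (hleft : ∀ x ∈ U, Ψ (Φ x) = x) (hright : ∀ y ∈ U', Φ (Ψ y) = y) (hΦN : Φ '' N = N' ∩ U')
    (hfin : (componentsOf Nᶜ).Finite) (hZ : ∀ C ∈ componentsOf Nᶜ, IsBallPiece N C)
    (hfr : ∀ C' ∈ componentsOf N'ᶜ, frontier C' ⊆ U' ∨ Disjoint (frontier C') U') :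
    IsNeckSurgeryResolvable X := by
  haveI : PathConnectedSpace X := inferInstance
  obtain ⟨Y, y, hY, ⟨e⟩⟩ := exists_diffeomorph_component_of_ballPieces hcerf hN hN' hU hNU hU' hΦc
    hΨc hΦ hΨ hleft hright hΦN hfin hZ hfin' hM hfr
  have hYsc : SimplyConnectedSpace Y :=
    (e.toHomeomorph.toHomotopyEquiv.simplyConnectedSpace_iff).1 inferInstance
  exact (IH Y ⟨y, hY⟩ hYsc).of_diffeomorph e.symm

/-- **The inner induction.** Let `M'` be a 4-manifold with closed `N' ⊆ M'` whose complement has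
finitely many components, all collared balls, and suppose every simply connected component of
`M'` is neck-surgery resolvable. Then every compact simply connected `X` carrying surgery data
`(N, U, U', Φ, Ψ)` relative to `(M', N')` (`Φ : U ≅ U'`, `Φ '' N = N' ∩ U'`, pieces of `X ∖ N`
necks and balls, boundary spheres of `M'`-pieces inside `U'` or disjoint from it) with at most
`k` non-ball pieces is neck-surgery resolvable: if all pieces are balls,
`isNeckSurgeryResolvable_of_ballPieces`; otherwise a non-ball piece is a neck `C₀ = ι₀ (S³ × (0,1))`,
the translated neck `ψ (θ, s) = ι₀ (θ, s + ½)` has two sides (`X` simply connected,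
`exists_neckCapData_of_simplyConnected`), both capped sides inherit the data with fewer non-ball
pieces (`exists_transport_neckCapData`) and are simply connected
(`NeckCapData.isConnectedSum_capped`, `IsConnectedSum.simplyConnectedSpace_left/right`), so
they are resolvable by induction, and `X` is resolvable by the `surgery` constructor —
Hamilton's "cutting the neck and rounding off the ends" (1997, §1.1).
[cite: Hamilton1997, §1.1 pp. 3–4] [cite: ChenZhu2006, Thm. 1.1 (ii)–(iii) (p. 3)] -/
theorem isNeckSurgeryResolvable_of_remainder (hcerf : cerf_pi0Diff_sphere_three)
    {N' : Set M'} (hN' : IsClosed N') (hfin' : (componentsOf N'ᶜ).Finite)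
    (hM : ∀ C' ∈ componentsOf N'ᶜ, IsBallPiece N' C')
    (IH : ∀ Y : Opens M', (∃ y, (Y : Set M') = connectedComponent y) →
      SimplyConnectedSpace Y → IsNeckSurgeryResolvable Y) (k : ℕ) :
    ∀ (X : Type) [TopologicalSpace X] [T2Space X] [CompactSpace X]
      [ChartedSpace (EuclideanSpace ℝ (Fin 4)) X] [IsManifold (𝓡 4) ∞ X] [SimplyConnectedSpace X]
      (N U : Set X) (U' : Set M') (Φ : X → M') (Ψ : M' → X),
      IsClosed N → IsOpen U → N ⊆ U → IsOpen U' →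
      ContMDiffOn (𝓡 4) (𝓡 4) ∞ Φ U → ContMDiffOn (𝓡 4) (𝓡 4) ∞ Ψ U' →
      MapsTo Φ U U' → MapsTo Ψ U' U →
      (∀ x ∈ U, Ψ (Φ x) = x) → (∀ y ∈ U', Φ (Ψ y) = y) → Φ '' N = N' ∩ U' →
      (componentsOf Nᶜ).Finite → (∀ C ∈ componentsOf Nᶜ, IsNeckPiece N C ∨ IsBallPiece N C) →
      {C ∈ componentsOf Nᶜ | ¬ IsBallPiece N C}.ncard ≤ k →
      (∀ C' ∈ componentsOf N'ᶜ, frontier C' ⊆ U' ∨ Disjoint (frontier C') U') →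
      IsNeckSurgeryResolvable X := by
  induction k with
  | zero =>
    intro X _ _ _ _ _ _ N U U' Φ Ψ hN hU hNU hU' hΦc hΨc hΦ hΨ hleft hright hΦN hfin hpieces hk hfr
    have hall : ∀ C ∈ componentsOf Nᶜ, IsBallPiece N C := by
      intro C hC
      by_contra hb
      have hmem : C ∈ {C ∈ componentsOf Nᶜ | ¬ IsBallPiece N C} := ⟨hC, hb⟩
      have hfinS : {C ∈ componentsOf Nᶜ | ¬ IsBallPiece N C}.Finite := hfin.subset (sep_subset _ _)
      have := (ncard_eq_zero hfinS).1 (Nat.le_zero.1 hk)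
      rw [this] at hmem
      exact hmem
    exact isNeckSurgeryResolvable_of_ballPieces hcerf hN' hfin' hM IH hN hU hNU hU' hΦc hΨc hΦ hΨ
      hleft hright hΦN hfin hall hfr
  | succ k ih =>
    intro X _ _ _ _ _ _ N U U' Φ Ψ hN hU hNU hU' hΦc hΨc hΦ hΨ hleft hright hΦN hfin hpieces hk hfr
    by_cases hall : ∀ C ∈ componentsOf Nᶜ, IsBallPiece N C
    · exact isNeckSurgeryResolvable_of_ballPieces hcerf hN' hfin' hM IH hN hU hNU hU' hΦc hΨc hΦ
        hΨ hleft hright hΦN hfin hall hfr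
    push Not at hall
    obtain ⟨C₀, hC₀, hC₀b⟩ := hall
    obtain ⟨ι₀, hι₀, hι₀o, hι₀C, hι₀N⟩ := (hpieces C₀ hC₀).resolve_right hC₀b
    haveI : Fact (Module.finrank ℝ (EuclideanSpace ℝ (Fin 4)) = 3 + 1) :=
      ⟨finrank_euclideanSpace_fin⟩
    haveI : PathConnectedSpace X := inferInstance
    -- the translated neck and its two sides
    set ψ : Metric.sphere (0 : EuclideanSpace ℝ (Fin 4)) 1 × ℝ → X :=
      fun q => ι₀ (q.1, q.2 + 1 / 2) with hψdef
    obtain ⟨hψ, hψr⟩ := isSmoothEmbedding_translate hι₀ (1 / 2)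
    have hψo : IsOpen (range ψ) := by rw [hψr]; exact hι₀o
    obtain ⟨D₁, D₂, hdisj, hcover⟩ := exists_neckCapData_of_simplyConnected (n := 3)
      (by norm_num) hψ hψo
    have hcs : IsConnectedSum 𝓘(ℝ, EuclideanSpace ℝ (Fin 4)) 𝓘(ℝ, EuclideanSpace ℝ (Fin 4))
        𝓘(ℝ, EuclideanSpace ℝ (Fin 4)) D₁.Capped D₂.Capped X :=
      D₁.isConnectedSum_capped D₂ (fun _ _ => rfl) hdisj hcover
    have h2 : 1 < Module.finrank ℝ (EuclideanSpace ℝ (Fin 4)) := by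
      rw [finrank_euclideanSpace_fin]; norm_num
    haveI : SimplyConnectedSpace D₁.Capped := hcs.simplyConnectedSpace_left h2
    haveI : SimplyConnectedSpace D₂.Capped := hcs.simplyConnectedSpace_right h2
    -- the neck presents `C₀`, in both orientations
    have hψC₀ : ψ '' (univ ×ˢ Ioo (-(1 / 2)) (1 / 2)) = C₀ := by
      rw [← hι₀C]
      apply Subset.antisymm
      · rintro _ ⟨⟨θ, s⟩, ⟨-, hs⟩, rfl⟩
        exact ⟨(θ, s + 1 / 2), ⟨mem_univ _, by linarith [hs.1], by linarith [hs.2]⟩, rfl⟩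
      · rintro _ ⟨⟨θ, t⟩, ⟨-, ht⟩, rfl⟩
        refine ⟨(θ, t - 1 / 2), ⟨mem_univ _, by linarith [ht.1], by linarith [ht.2]⟩, ?_⟩
        show ι₀ (θ, t - 1 / 2 + 1 / 2) = ι₀ (θ, t)
        rw [sub_add_cancel]
    have hψN : ∀ (θ : Metric.sphere (0 : EuclideanSpace ℝ (Fin 4)) 1) (s : ℝ), 1 / 2 ≤ |s| →
        ψ (θ, s) ∈ N := by
      intro θ s hs
      refine hι₀N ⟨(θ, s + 1 / 2), ⟨mem_univ _, fun h => ?_⟩, rfl⟩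
      rcases le_abs'.1 hs with h' | h'
      · linarith [h.1]
      · linarith [h.2]
    have hψ'C₀ : (fun q : Metric.sphere (0 : EuclideanSpace ℝ (Fin 4)) 1 × ℝ => ψ (q.1, -q.2)) ''
        (univ ×ˢ Ioo (-(1 / 2)) (1 / 2)) = C₀ := by
      rw [← hψC₀]
      apply Subset.antisymm
      · rintro _ ⟨⟨θ, s⟩, ⟨-, hs⟩, rfl⟩
        exact ⟨(θ, -s), ⟨mem_univ _, by linarith [hs.2], by linarith [hs.1]⟩, rfl⟩
      · rintro _ ⟨⟨θ, s⟩, ⟨-, hs⟩, rfl⟩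
        refine ⟨(θ, -s), ⟨mem_univ _, by linarith [hs.2], by linarith [hs.1]⟩, ?_⟩
        show ψ (θ, - -s) = ψ (θ, s)
        rw [neg_neg]
    have hψ'N : ∀ (θ : Metric.sphere (0 : EuclideanSpace ℝ (Fin 4)) 1) (s : ℝ), 1 / 2 ≤ |s| →
        (fun q : Metric.sphere (0 : EuclideanSpace ℝ (Fin 4)) 1 × ℝ => ψ (q.1, -q.2)) (θ, s) ∈ N :=
      fun θ s hs => hψN θ (-s) (by rwa [abs_neg])
    -- transport to both capped sides and apply the induction hypothesis
    obtain ⟨N₁, U₁, U₁', Φ₁, Ψ₁, hN₁, hU₁, hNU₁, hU₁', hΦ₁c, hΨ₁c, hm₁, hm₁', hl₁, hr₁, him₁,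
      hfin₁, hp₁, hcount₁, hfr₁⟩ :=
      exists_transport_neckCapData hN hN' hU hNU hU' hΦc hΨc hΦ hΨ hleft hright hΦN hfin hpieces hM
        hfr hC₀ hC₀b D₁ hψC₀ hψN
    obtain ⟨N₂, U₂, U₂', Φ₂, Ψ₂, hN₂, hU₂, hNU₂, hU₂', hΦ₂c, hΨ₂c, hm₂, hm₂', hl₂, hr₂, him₂,
      hfin₂, hp₂, hcount₂, hfr₂⟩ :=
      exists_transport_neckCapData hN hN' hU hNU hU' hΦc hΨc hΦ hΨ hleft hright hΦN hfin hpieces hM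
        hfr hC₀ hC₀b D₂ hψ'C₀ hψ'N
    have h₁ : IsNeckSurgeryResolvable D₁.Capped :=
      ih D₁.Capped N₁ U₁ U₁' Φ₁ Ψ₁ hN₁ hU₁ hNU₁ hU₁' hΦ₁c hΨ₁c hm₁ hm₁' hl₁ hr₁ him₁ hfin₁ hp₁
        (by omega) hfr₁
    have h₂ : IsNeckSurgeryResolvable D₂.Capped :=
      ih D₂.Capped N₂ U₂ U₂' Φ₂ Ψ₂ hN₂ hU₂ hNU₂ hU₂' hΦ₂c hΨ₂c hm₂ hm₂' hl₂ hr₂ him₂ hfin₂ hp₂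
        (by omega) hfr₂
    exact IsNeckSurgeryResolvable.surgery D₁ D₂ hdisj hcover h₁ h₂

end Inner

/-! ### The outer induction over the surgeries of Chen–Zhu's Theorem 1.1 -/

section Outer

/-- **Every simply connected component of a manifold resolved by a Ricci flow with `m`
surgeries is neck-surgery resolvable** (given Cerf's theorem). Induction on `m` in
`ChenZhuResolvableIn m M g₀` (`SurgicalRicciFlow.lean`): for `m = 0`, `M` is a finite union of
pieces and every component is an iterated connected sum of Hamilton's pieces
(`IsUnionOfPieces.exists_isNeckSurgeryResolvable_component`); for `m + 1`, the surgery step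
`IsSurgeryStep g T g₀'` to `M'` is restricted to the component `X`
(`exists_restrict_component`): `X` is a discarded piece (resolvable), or contains a projective
cap (impossible, `X` being simply connected), or carries surgery data with neck and ball pieces,
and then `isNeckSurgeryResolvable_of_remainder` applies with the induction hypothesis for `M'`.
[cite: ChenZhu2006, Thm. 1.1 (p. 3) and §5, p. 25] [cite: Hamilton1997, §1.1 pp. 3–4] -/
theorem forall_component_isNeckSurgeryResolvable_of_chenZhuResolvableIn
    (hcerf : cerf_pi0Diff_sphere_three) (m : ℕ) :
    ∀ (M : Type) [TopologicalSpace M] [T2Space M] [SecondCountableTopology M] [CompactSpace M]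
      [ChartedSpace (EuclideanSpace ℝ (Fin 4)) M] [IsManifold (𝓡 4) ∞ M]
      (g₀ : PseudoRiemannianMetric (𝓡 4) ∞ (EuclideanSpace ℝ (Fin 4))
        (TangentSpace (𝓡 4) : M → Type _)),
      ChenZhuResolvableIn m M g₀ →
      ∀ X : Opens M, (∃ x, (X : Set M) = connectedComponent x) → SimplyConnectedSpace X →
        IsNeckSurgeryResolvable X := by
  induction m with
  | zero =>
    intro M _ _ _ _ _ _ g₀ h X hX hXsc
    rw [chenZhuResolvableIn_zero_iff] at h
    obtain ⟨-, -, -, -, -, hpieces⟩ := h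
    obtain ⟨x, hx⟩ := hX
    obtain ⟨C, hC, hres⟩ := hpieces.exists_isNeckSurgeryResolvable_component x
    have : C = X := Opens.ext (hC.trans hx.symm)
    exact this ▸ hres
  | succ m ih =>
    intro M _ _ _ _ _ _ g₀ h X hX hXsc
    rw [chenZhuResolvableIn_succ_iff] at h
    obtain ⟨g, cov, T, -, -, M', i₁, i₂, i₃, i₄, i₅, i₆, g₀', hstep, hres'⟩ := h
    obtain ⟨U, N, gbar, N', hU, hNU, -, -, hNreg, hN'reg, hiso, hpre, hpost⟩ := hstep
    obtain ⟨U₂, U₂', Φ, Ψ, hU₂, hNU₂, hU₂', hN'U₂', hΦc, hΨc, hΦ, hΨ, hleft, hright, hΦN, -⟩ := hiso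
    haveI : LocallyConnectedSpace M' :=
      ChartedSpace.locallyConnectedSpace (EuclideanSpace ℝ (Fin 4)) M'
    have hN : IsClosed N := hNreg.isClosed
    have hN' : IsClosed N' := hN'reg.isClosed
    have hΦN' : Φ '' N = N' ∩ U₂' := by rw [hΦN, inter_eq_left.2 hN'U₂']
    have hfr : ∀ C' ∈ componentsOf N'ᶜ, frontier C' ⊆ U₂' ∨ Disjoint (frontier C') U₂' := by
      intro C' hC'
      left
      rw [(isOpen_of_mem_componentsOf hN'.isOpen_compl hC').frontier_eq]
      exact (IsBallPiece.closure_diff_subset (hpost.2 C' hC')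
        (disjoint_of_mem_componentsOf_compl hC')).trans hN'U₂'
    -- the component `X`
    obtain ⟨x, hx⟩ := hX
    have hXc : IsClosed (X : Set M) := hx ▸ isClosed_connectedComponent
    have hXp : IsPreconnected (X : Set M) := hx ▸ isPreconnected_connectedComponent
    haveI : Nonempty X := ⟨⟨x, show x ∈ (X : Set M) from hx ▸ mem_connectedComponent⟩⟩
    haveI : CompactSpace X := isCompact_iff_compactSpace.1 hXc.isCompact
    rcases exists_restrict_component hN hN' hU₂ hNU₂ hU₂' hΦc hΨc hΦ hΨ hleft hright hΦN' hpre.1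
      hpre.2 hpost.2 hfr X hXc hXp with hd | hnsc | hdata
    · exact .of_isConnectedSumOf_isHamiltonPICPiece hd.2
    · exact absurd hXsc hnsc
    · obtain ⟨N₁, U₁, U₁', Φ₁, Ψ₁, hN₁, hU₁, hNU₁, hU₁', hΦ₁c, hΨ₁c, hm₁, hm₁', hl₁, hr₁, him₁,
        hfin₁, hp₁, hfr₁⟩ := hdata
      exact isNeckSurgeryResolvable_of_remainder hcerf hN' hpost.1 hpost.2
        (fun Y hY hYsc => ih M' g₀' hres' Y hY hYsc) _ X N₁ U₁ U₁' Φ₁ Ψ₁ hN₁ hU₁ hNU₁ hU₁' hΦ₁c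
        hΨ₁c hm₁ hm₁' hl₁ hr₁ him₁ hfin₁ hp₁ le_rfl hfr₁

/-! ### The bridge theorems -/

/-- **Chen–Zhu's Theorem 1.1 and Cerf's theorem imply neck-surgery resolvability**: a closed
simply connected 4-manifold carrying a Riemannian metric of positive isotropic curvature is
neck-surgery resolvable (`IsNeckSurgeryResolvable`, `HamiltonSurgeryProgramme.lean`) — apply
Thm. 1.1 to get `ChenZhuResolvableIn m M g`, and
`forall_component_isNeckSurgeryResolvable_of_chenZhuResolvableIn` to the single component of `M`.
This is Hamilton's surgery programme (1997, §1.1 pp. 3–4: "After a finite number of surgeries in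
a finite time, and discarding a finite number of pieces, we are left with nothing") in the simply
connected case, obtained from the two hypotheses; it is not a named fact of its own (manifold
by manifold it is equivalent to Cor. 1.2(a), by `IsNeckSurgeryResolvable.isConnectedSumOfSpheres`
with `S⁴ # S⁴ ≅ S⁴`, and conversely `S⁴` is a model piece). [cite: ChenZhu2006, Thm. 1.1 and Cor. 1.2 (p. 3)]
[cite: Hamilton1997, §1.1 pp. 3–4] [cite: CerfDiffeoSphere1968, Ch. I §1, Théorème 1] -/
theorem isNeckSurgeryResolvable_of_chenZhu_of_cerf
    (hCZ : ∀ (M : Type) [TopologicalSpace M] [T2Space M] [SecondCountableTopology M]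
        [CompactSpace M] [ChartedSpace (EuclideanSpace ℝ (Fin 4)) M] [IsManifold (𝓡 4) ∞ M]
        [SimplyConnectedSpace M]
        (g₀ : Literature.Geometry.Lorentzian.PseudoRiemannianMetric (𝓡 4) ∞
          (EuclideanSpace ℝ (Fin 4)) (TangentSpace (𝓡 4) : M → Type _)),
        g₀.IsRiemannian → g₀.HasPositiveIsotropicCurvature → ∃ m : ℕ, ChenZhuResolvableIn m M g₀)
    (hcerf : cerf_pi0Diff_sphere_three) (M : Type) [TopologicalSpace M] [T2Space M]
    [SecondCountableTopology M] [ChartedSpace (EuclideanSpace ℝ (Fin 4)) M]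
    [IsManifold (𝓡 4) ∞ M] [CompactSpace M] [SimplyConnectedSpace M]
    (hg : ∃ g : PseudoRiemannianMetric (𝓡 4) ∞ (EuclideanSpace ℝ (Fin 4))
        (TangentSpace (𝓡 4) : M → Type _), g.IsRiemannian ∧ g.HasPositiveIsotropicCurvature) :
    IsNeckSurgeryResolvable M := by
  obtain ⟨g, hg, hpic⟩ := hg
  obtain ⟨m, hm⟩ := hCZ M g hg hpic
  haveI : PathConnectedSpace M := inferInstance
  obtain ⟨x⟩ := (inferInstance : Nonempty M)
  have htop : ((⊤ : Opens M) : Set M) = univ := rfl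
  obtain ⟨e⟩ := nonempty_diffeomorph_opens_of_coe_eq_univ (I := 𝓡 4) (⊤ : Opens M) htop
  have hsc : SimplyConnectedSpace (⊤ : Opens M) :=
    (e.toHomeomorph.toHomotopyEquiv.simplyConnectedSpace_iff).1 inferInstance
  have hres := forall_component_isNeckSurgeryResolvable_of_chenZhuResolvableIn hcerf m M g hm ⊤
    ⟨x, by rw [htop, PreconnectedSpace.connectedComponent_eq_univ]⟩ hsc
  exact hres.of_diffeomorph e.symm

/-- **Hamilton's Thm. 1.1 in connected-sum-of-spheres form (`hamilton_pic_connectedSum_spheres_four`)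
from Chen–Zhu's Thm. 1.1 and Cerf's theorem**: a resolvable simply connected manifold is a
connected sum of copies of `S⁴` (`IsNeckSurgeryResolvable.isConnectedSumOfSpheres`,
`HamiltonSurgeryProgramme.lean`; Hamilton 1997, p. 4: "We can then recover the original manifold
by … doing surgeries replacing two `B⁴`'s with an `S³ × B¹`").
[cite: Hamilton1997, Thm. 1.1 (p. 2) and §1.1 pp. 3–4] [cite: ChenZhu2006, Thm. 1.1 and Cor. 1.2 (p. 3)] -/
theorem hamilton_pic_connectedSum_spheres_four_of_chenZhu_of_cerf
    (hCZ : ∀ (M : Type) [TopologicalSpace M] [T2Space M] [SecondCountableTopology M]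
        [CompactSpace M] [ChartedSpace (EuclideanSpace ℝ (Fin 4)) M] [IsManifold (𝓡 4) ∞ M]
        [SimplyConnectedSpace M]
        (g₀ : Literature.Geometry.Lorentzian.PseudoRiemannianMetric (𝓡 4) ∞
          (EuclideanSpace ℝ (Fin 4)) (TangentSpace (𝓡 4) : M → Type _)),
        g₀.IsRiemannian → g₀.HasPositiveIsotropicCurvature → ∃ m : ℕ, ChenZhuResolvableIn m M g₀)
    (hcerf : cerf_pi0Diff_sphere_three) :
    hamilton_pic_connectedSum_spheres_four := by
  intro M _ _ _ _ _ _ _ hg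
  exact (isNeckSurgeryResolvable_of_chenZhu_of_cerf hCZ hcerf M hg).isConnectedSumOfSpheres ‹_›

/-- Hamilton's Cor. 1.2(a) in the form `hamilton_pic_sphere_four` (`PICSphereFacts.lean`) from
Chen–Zhu's Thm. 1.1 and Cerf's theorem: connected sum of `S⁴`'s, then `S⁴ # S⁴ ≅ S⁴`
(Kervaire–Milnor 1963, Lemma 2.1, proved in the tree;
`hamilton_pic_sphere_four_of_hamilton_pic_connectedSum_spheres_four`).
[cite: Hamilton1997, Cor. 1.2(a) (p. 3)] -/
theorem hamilton_pic_sphere_four_of_chenZhu_of_cerf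
    (hCZ : ∀ (M : Type) [TopologicalSpace M] [T2Space M] [SecondCountableTopology M]
        [CompactSpace M] [ChartedSpace (EuclideanSpace ℝ (Fin 4)) M] [IsManifold (𝓡 4) ∞ M]
        [SimplyConnectedSpace M]
        (g₀ : Literature.Geometry.Lorentzian.PseudoRiemannianMetric (𝓡 4) ∞
          (EuclideanSpace ℝ (Fin 4)) (TangentSpace (𝓡 4) : M → Type _)),
        g₀.IsRiemannian → g₀.HasPositiveIsotropicCurvature → ∃ m : ℕ, ChenZhuResolvableIn m M g₀)
    (hcerf : cerf_pi0Diff_sphere_three) : hamilton_pic_sphere_four :=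
  hamilton_pic_sphere_four_of_hamilton_pic_connectedSum_spheres_four
    (hamilton_pic_connectedSum_spheres_four_of_chenZhu_of_cerf hCZ hcerf)

/-- **Hamilton's Cor. 1.2(a) from Chen–Zhu's Thm. 1.1 and Cerf's theorem**: the named fact
`Literature.Geometry.Riemannian.hamilton_chen_tang_zhu` (a compact simply connected 4-manifold
with a PIC metric is diffeomorphic to `S⁴`) follows from the structure statement of Chen–Zhu's
Thm. 1.1 and `cerf_pi0Diff_sphere_three` (`hamilton_chen_tang_zhu_of_hamilton_pic_connectedSum_spheres_four`).
[cite: Hamilton1997, Cor. 1.2(a) (p. 3)] [cite: ChenZhu2006, Thm. 1.1 and Cor. 1.2 (p. 3)] -/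
theorem hamilton_chen_tang_zhu_of_chenZhu_of_cerf
    (hCZ : ∀ (M : Type) [TopologicalSpace M] [T2Space M] [SecondCountableTopology M]
        [CompactSpace M] [ChartedSpace (EuclideanSpace ℝ (Fin 4)) M] [IsManifold (𝓡 4) ∞ M]
        [SimplyConnectedSpace M]
        (g₀ : Literature.Geometry.Lorentzian.PseudoRiemannianMetric (𝓡 4) ∞
          (EuclideanSpace ℝ (Fin 4)) (TangentSpace (𝓡 4) : M → Type _)),
        g₀.IsRiemannian → g₀.HasPositiveIsotropicCurvature → ∃ m : ℕ, ChenZhuResolvableIn m M g₀)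
    (hcerf : cerf_pi0Diff_sphere_three) : hamilton_chen_tang_zhu :=
  hamilton_chen_tang_zhu_of_hamilton_pic_connectedSum_spheres_four
    (hamilton_pic_connectedSum_spheres_four_of_chenZhu_of_cerf hCZ hcerf)

/-- Hamilton's Thm. 1.1 with the printed list of pieces (`hamilton_pic_classification_four`,
simply connected case) from Chen–Zhu's Thm. 1.1 and Cerf's theorem
(`hamilton_pic_classification_four_of_connectedSum_spheres`). [cite: Hamilton1997, Thm. 1.1 (p. 2)] -/
theorem hamilton_pic_classification_four_of_chenZhu_of_cerf
    (hCZ : ∀ (M : Type) [TopologicalSpace M] [T2Space M] [SecondCountableTopology M]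
        [CompactSpace M] [ChartedSpace (EuclideanSpace ℝ (Fin 4)) M] [IsManifold (𝓡 4) ∞ M]
        [SimplyConnectedSpace M]
        (g₀ : Literature.Geometry.Lorentzian.PseudoRiemannianMetric (𝓡 4) ∞
          (EuclideanSpace ℝ (Fin 4)) (TangentSpace (𝓡 4) : M → Type _)),
        g₀.IsRiemannian → g₀.HasPositiveIsotropicCurvature → ∃ m : ℕ, ChenZhuResolvableIn m M g₀)
    (hcerf : cerf_pi0Diff_sphere_three) : hamilton_pic_classification_four :=
  hamilton_pic_classification_four_of_connectedSum_spheres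
    (hamilton_pic_connectedSum_spheres_four_of_chenZhu_of_cerf hCZ hcerf)

end Outer

end Literature.Geometry.Riemannian
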